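/-
Copyright: derived here (Resolution Observatory cell `pub-rosobs`, carver gen 61). AI-written Lean; AI review is
weaker than expert review.  Companion file of the cell's POLYNOMIAL weighted-centre model `W(f)` (engine 1's `W(f)` /
(P)-system TOY MODEL; THEOREM-F-eng1-g40 §3 STEP 2 "the shape of `X` is forced by the weights", CARVER-NOTES-eng1-g40 T79).
Instrument — NOT a resolution theorem and NOT a statement about the invariant of [AbramovichTemkinWlodarczyk2024].
-/
import Literature.AlgebraicGeometry.Resolution.WeightedCentreGradedIsotropy
import Mathlib.RingTheory.MvPolynomial.WeightedHomogeneous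
import Mathlib.Data.Finsupp.Weight
import Mathlib.Tactic.Linarith
import HarnessLib

/-!
# The shape of a graded substitution one notch below the weight floor (THEOREM-F STEP 2)

Setting of `WeightedCentreGradedIsotropy`: `A₀ = k[ε_ι]` with RATIONAL weights `w : ι → ℚ`, `A₀[σ] = A₀[X]`,
`deg σ = ρ > 0`, and a graded ring endomorphism `Φ` (`IsGradedHom w ρ Φ`: the `σ^s`-coefficient of `Φ(ε_i)` is
`w`-homogeneous of weight `w i − sρ`).  THEOREM F of the cell (engine 1, gen 40) runs at `ρ = ρ₁ = 1/(p(p+1))` with the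
WEIGHT FLOOR `w_min = 1/(p+1) = pρ` and the `f`-class `1/p = (p+1)ρ`; this file is its STEP 2, stated for an arbitrary
floor `c = pρ` (`p : ℕ`, `0 < p`), every weight `≥ pρ`:

* weight bookkeeping below the floor (`WeightFloor`): a non-zero exponent vector weighs `≥ c`, one of degree `≥ 2`
  weighs `≥ 2c`; hence a `w`-homogeneous polynomial of weight `m < c` is the constant `C (coeff 0)`
  (`IsWeightedHomogeneous.eq_C_of_weight_lt`) and vanishes if `m ≠ 0` (`eq_zero_of_weight_lt`); one of weight exactly
  `c > 0` is a LINEAR FORM in the slots of weight `c` (`eq_sum_C_mul_X_of_weight_eq_floor`);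
* **STEP 2** for a graded `Φ` with `Φ ≡ id (mod σ)` on the slot in question (`(Φ(C ε_j)).coeff 0 = ε_j`):
  - a slot STRICTLY BETWEEN the floor and the `f`-class, `pρ < w j < (p+1)ρ` (the `I`-slots), is FIXED
    (`IsGradedHom.apply_CX_eq_of_btwn`: every `σ^s`-term, `s ≥ 1`, would weigh `< pρ`, so be a constant of weight
    `w j − sρ ≠ 0`);
  - a FLOOR slot `w n = pρ` (the `W`-slots) carries at most the pure term `c·σ^p`, so it is fixed iff `pureCoeff Φ n p = 0`
    (`IsGradedHom.apply_CX_eq_of_floor`);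
  - an `f`-CLASS slot `w i = (p+1)ρ` has `Φ(C ε_i) = C ε_i + σ·C M_i + C(C d_i)·σ^{p+1}` with `M_i = [σ¹]Φ(C ε_i)` a linear
    form in the floor slots and `d_i = pureCoeff Φ i (p+1) ∈ k` (`IsGradedHom.apply_CX_eq_of_fclass`,
    `IsGradedHom.coeff_one_eq_sum_of_fclass`) — exactly the face form `Φ(C f₁) = C f₁ + X·C ℓ + C d·X^{p+1}` consumed by
    `WeightedCentreLowestTaylor` (leaves (a)/(b) of the second proof of THEOREM F).
  Slots ABOVE the `f`-class are not constrained here (in THEOREM F they are fixed by the LEMMA-XL normal form).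

No characteristic hypothesis.  References: the weights/gradings are those of weighted blow-ups
[AbramovichTemkinWlodarczyk2024, §5.1 (p. 1575), Thm. 5.3.1 (2)–(3) (p. 1578)] (CONTEXT ONLY); polynomial bookkeeping
[Lang2002, Ch. IV §1].  The statements are engine 1's (THEOREM-F-eng1-g40 §3 STEP 2), the formalisation ours.
-/

namespace Literature.AlgebraicGeometry.Resolution.WeightedBlowup

open Polynomial

/-! ## Weight bookkeeping below the floor -/

section WeightFloor

variable {k : Type*} [CommRing k] {ι : Type*} {w : ι → ℚ} {c : ℚ}

/-- `degree(d)·c ≤ weight(d)` when every weight is `≥ c` (ours, bookkeeping). [cite: AbramovichTemkinWlodarczyk2024, §5.1 (p. 1575)] -/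
theorem degree_mul_le_weight (hw : ∀ i, c ≤ w i) (d : ι →₀ ℕ) : (d.degree : ℚ) * c ≤ Finsupp.weight w d := by
  rw [Finsupp.degree_apply, Finsupp.weight_apply, Finsupp.sum, Nat.cast_sum, Finset.sum_mul]
  exact Finset.sum_le_sum fun i _ => by
    rw [nsmul_eq_mul]
    exact mul_le_mul_of_nonneg_left (hw i) (Nat.cast_nonneg _)

/-- A non-zero exponent vector weighs at least the floor `c ≥ 0` (ours, bookkeeping). [cite: AbramovichTemkinWlodarczyk2024, §5.1 (p. 1575)] -/
theorem le_weight_of_ne_zero (hw : ∀ i, c ≤ w i) (hc : 0 ≤ c) {d : ι →₀ ℕ} (hd : d ≠ 0) : c ≤ Finsupp.weight w d := by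
  have h1 : 1 ≤ d.degree := Nat.one_le_iff_ne_zero.mpr fun h => hd ((Finsupp.degree_eq_zero_iff d).mp h)
  calc c = (1 : ℚ) * c := (one_mul c).symm
    _ ≤ (d.degree : ℚ) * c := mul_le_mul_of_nonneg_right (by exact_mod_cast h1) hc
    _ ≤ _ := degree_mul_le_weight hw d

/-- An exponent vector of degree `≥ 2` weighs at least `2c` (ours, bookkeeping). [cite: AbramovichTemkinWlodarczyk2024, §5.1 (p. 1575)] -/
theorem two_mul_le_weight_of_two_le_degree (hw : ∀ i, c ≤ w i) (hc : 0 ≤ c) {d : ι →₀ ℕ} (hd : 2 ≤ d.degree) :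
    2 * c ≤ Finsupp.weight w d :=
  calc 2 * c ≤ (d.degree : ℚ) * c := mul_le_mul_of_nonneg_right (by exact_mod_cast hd) hc
    _ ≤ _ := degree_mul_le_weight hw d

/-- **Below the floor only constants**: a `w`-homogeneous polynomial of weight `m < c` (all weights `≥ c ≥ 0`) is the constant
`C (coeff 0)` (derived here). [cite: Lang2002, Ch. IV §1] -/
theorem _root_.MvPolynomial.IsWeightedHomogeneous.eq_C_of_weight_lt {a : MvPolynomial ι k} {m : ℚ}
    (ha : MvPolynomial.IsWeightedHomogeneous w a m) (hw : ∀ i, c ≤ w i) (hc : 0 ≤ c) (hm : m < c) :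
    a = MvPolynomial.C (a.coeff 0) := by
  classical
  refine MvPolynomial.ext _ _ fun d => ?_
  rw [MvPolynomial.coeff_C]
  split_ifs with hd
  · rw [← hd]
  · by_contra hne
    have hwt : Finsupp.weight w d = m := ha hne
    have := le_weight_of_ne_zero hw hc (Ne.symm hd)
    rw [hwt] at this
    exact absurd hm (not_lt.mpr this)

/-- … and it vanishes when `m ≠ 0` (derived here). [cite: Lang2002, Ch. IV §1] -/
theorem _root_.MvPolynomial.IsWeightedHomogeneous.eq_zero_of_weight_lt {a : MvPolynomial ι k} {m : ℚ}
    (ha : MvPolynomial.IsWeightedHomogeneous w a m) (hw : ∀ i, c ≤ w i) (hc : 0 ≤ c) (hm : m < c) (hm0 : m ≠ 0) :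
    a = 0 := by
  rw [ha.eq_C_of_weight_lt hw hc hm]
  by_cases h0 : a.coeff 0 = 0
  · rw [h0, map_zero]
  · have h : Finsupp.weight w (0 : ι →₀ ℕ) = m := ha h0
    rw [map_zero] at h
    exact absurd h.symm hm0

/-- **At the floor only linear monomials**: every exponent vector in the support of a `w`-homogeneous polynomial of weight
exactly the floor `c > 0` is a single slot `e_n` of weight `c` (derived here). [cite: Lang2002, Ch. IV §1] -/
theorem _root_.MvPolynomial.IsWeightedHomogeneous.eq_single_of_mem_support {a : MvPolynomial ι k}
    (ha : MvPolynomial.IsWeightedHomogeneous w a c) (hw : ∀ i, c ≤ w i) (hc : 0 < c) {d : ι →₀ ℕ}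
    (hd : d ∈ a.support) : ∃ n, d = Finsupp.single n 1 ∧ w n = c := by
  have hwt : Finsupp.weight w d = c := ha (MvPolynomial.mem_support_iff.mp hd)
  have hd0 : d ≠ 0 := fun h => by
    rw [h, map_zero] at hwt
    exact hc.ne hwt
  have hdeg : d.degree = 1 := by
    have h1 : d.degree ≠ 0 := fun h => hd0 ((Finsupp.degree_eq_zero_iff d).mp h)
    by_contra hne
    have h2 : 2 ≤ d.degree := by omega
    have := two_mul_le_weight_of_two_le_degree hw hc.le h2
    rw [hwt] at this
    linarith
  obtain ⟨n, hn⟩ : d ∈ Set.range (fun a : ι => Finsupp.single a 1) := by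
    rw [Finsupp.range_single_one]; exact hdeg
  refine ⟨n, hn.symm, ?_⟩
  rw [← hn, Finsupp.weight_single, one_smul] at hwt
  exact hwt

/-- **At the floor only linear forms**: a `w`-homogeneous polynomial of weight exactly the floor `c > 0` is the linear form
`Σ_{w n = c} coeff_{e_n}(a)·X_n` in the floor slots (derived here; THEOREM-F STEP 2: "`σ¹·M` with `M` a linear form in the
`W`-variables"). [cite: Lang2002, Ch. IV §1] -/
theorem _root_.MvPolynomial.IsWeightedHomogeneous.eq_sum_C_mul_X_of_weight_eq_floor [Fintype ι] [DecidableEq ι]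
    {a : MvPolynomial ι k} (ha : MvPolynomial.IsWeightedHomogeneous w a c) (hw : ∀ i, c ≤ w i) (hc : 0 < c) :
    a = ∑ n ∈ Finset.univ.filter (fun n => w n = c),
      MvPolynomial.C (a.coeff (Finsupp.single n 1)) * MvPolynomial.X n := by
  refine MvPolynomial.ext _ _ fun d => ?_
  rw [MvPolynomial.coeff_sum]
  simp_rw [MvPolynomial.coeff_C_mul, MvPolynomial.coeff_X]
  by_cases hd : d ∈ a.support
  · obtain ⟨n, rfl, hn⟩ := ha.eq_single_of_mem_support hw hc hd
    rw [Finset.sum_eq_single_of_mem n (Finset.mem_filter.mpr ⟨Finset.mem_univ _, hn⟩) fun m _ hm => by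
      rw [if_neg (fun h => hm (Finsupp.single_left_injective one_ne_zero h)), mul_zero]]
    rw [if_pos rfl, mul_one]
  · rw [MvPolynomial.notMem_support_iff.mp hd]
    symm
    refine Finset.sum_eq_zero fun n _ => ?_
    split_ifs with h
    · rw [← h] at hd
      rw [MvPolynomial.notMem_support_iff.mp hd, zero_mul]
    · rw [mul_zero]

end WeightFloor

/-! ## A polynomial in `σ` is determined by its coefficients (plumbing for the face form) -/

section FaceForm

variable {A : Type*} [CommRing A]

/-- If `f` has `[σ⁰] = a`, `[σ¹] = M`, `[σ^q] = d` (`1 < q`) and no other coefficient, then `f = C a + σ·C M + C d·σ^q` (ours,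
bookkeeping: the face form of `WeightedCentreLowestTaylor`). [cite: Lang2002, Ch. IV §1] -/
theorem eq_faceForm_of_coeff {f : A[X]} {a M d : A} {q : ℕ} (hq : 1 < q) (h0 : f.coeff 0 = a) (h1 : f.coeff 1 = M)
    (hq' : f.coeff q = d) (hother : ∀ s, s ≠ 0 → s ≠ 1 → s ≠ q → f.coeff s = 0) :
    f = C a + X * C M + C d * X ^ q := by
  refine Polynomial.ext fun s => ?_
  rw [X_mul, coeff_add, coeff_add, coeff_C, coeff_C_mul_X, coeff_C_mul_X_pow]
  by_cases hs0 : s = 0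
  · subst hs0
    rw [if_pos rfl, if_neg (by omega), if_neg (by omega), add_zero, add_zero, h0]
  by_cases hs1 : s = 1
  · subst hs1
    rw [if_neg (by omega), if_pos rfl, if_neg (by omega), zero_add, add_zero, h1]
  by_cases hsq : s = q
  · subst hsq
    rw [if_neg hs0, if_neg hs1, if_pos rfl, zero_add, zero_add, hq']
  · rw [if_neg hs0, if_neg hs1, if_neg hsq, add_zero, add_zero, hother s hs0 hs1 hsq]

end FaceForm

/-! ## STEP 2: the shape of a graded substitution -/

section Shape

variable {k : Type*} [CommRing k] {ι : Type*} {w : ι → ℚ} {ρ : ℚ} {p : ℕ}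
  {Φ : (MvPolynomial ι k)[X] →+* (MvPolynomial ι k)[X]}

/-- The `σ^s`-coefficient of `Φ(C ε_i)` is `w`-homogeneous of weight `w i − sρ` (restatement of `IsGradedHom.isTW_CX` with
`s • ρ = s·ρ`; ours). [cite: AbramovichTemkinWlodarczyk2024, Thm. 5.3.1 (2)–(3) (p. 1578)] -/
theorem IsGradedHom.isWeightedHomogeneous_coeff_CX (hΦ : IsGradedHom w ρ Φ) (i : ι) (s : ℕ) :
    MvPolynomial.IsWeightedHomogeneous w ((Φ (C (MvPolynomial.X i))).coeff s) (w i - s * ρ) := by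
  have h := hΦ.isTW_CX i s
  rwa [nsmul_eq_mul] at h

/-- A Taylor coefficient weighing below the floor is the PURE constant `C (pureCoeff Φ i s)` (derived here).
[cite: AbramovichTemkinWlodarczyk2024, Thm. 5.3.1 (2)–(3) (p. 1578)] -/
theorem IsGradedHom.coeff_CX_eq_C_pureCoeff (hΦ : IsGradedHom w ρ Φ) {c : ℚ} (hw : ∀ j, c ≤ w j) (hc : 0 ≤ c) {i : ι}
    {s : ℕ} (hs : w i - s * ρ < c) : (Φ (C (MvPolynomial.X i))).coeff s = MvPolynomial.C (pureCoeff Φ i s) :=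
  (hΦ.isWeightedHomogeneous_coeff_CX i s).eq_C_of_weight_lt hw hc hs

/-- … and vanishes unless `w i = sρ` (derived here). [cite: AbramovichTemkinWlodarczyk2024, Thm. 5.3.1 (2)–(3) (p. 1578)] -/
theorem IsGradedHom.coeff_CX_eq_zero (hΦ : IsGradedHom w ρ Φ) {c : ℚ} (hw : ∀ j, c ≤ w j) (hc : 0 ≤ c) {i : ι} {s : ℕ}
    (hs : w i - s * ρ < c) (hne : w i ≠ s * ρ) : (Φ (C (MvPolynomial.X i))).coeff s = 0 :=
  (hΦ.isWeightedHomogeneous_coeff_CX i s).eq_zero_of_weight_lt hw hc hs (sub_ne_zero.mpr hne)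

/-- **STEP 2, slots strictly between the floor and the `f`-class are fixed** (derived here): weights `≥ pρ` (`ρ ≥ 0`),
`Φ ≡ id (mod σ)` on `ε_j`, and `pρ < w j < (p+1)ρ` ⇒ `Φ(C ε_j) = C ε_j` — a `σ^s`-term (`s ≥ 1`) would weigh `w j − sρ < pρ`,
so be a constant, of non-zero weight since `w j ∉ ℕρ`. (THEOREM-F STEP 2: "X fixes `I`".)
[cite: AbramovichTemkinWlodarczyk2024, Thm. 5.3.1 (2)–(3) (p. 1578)] -/
theorem IsGradedHom.apply_CX_eq_of_btwn (hΦ : IsGradedHom w ρ Φ) (hρ : 0 ≤ ρ) (hw : ∀ j, p * ρ ≤ w j) {j : ι}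
    (h0 : (Φ (C (MvPolynomial.X j))).coeff 0 = MvPolynomial.X j) (hlo : p * ρ < w j) (hhi : w j < (p + 1) * ρ) :
    Φ (C (MvPolynomial.X j)) = C (MvPolynomial.X j) := by
  have hc : (0 : ℚ) ≤ p * ρ := mul_nonneg (Nat.cast_nonneg p) hρ
  refine Polynomial.ext fun s => ?_
  rw [coeff_C]
  split_ifs with hs
  · subst hs; exact h0
  · have hs1 : (1 : ℚ) ≤ s := by exact_mod_cast Nat.one_le_iff_ne_zero.mpr hs
    refine hΦ.coeff_CX_eq_zero hw hc ?_ ?_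
    · nlinarith
    · intro heq
      rcases Nat.lt_or_ge s (p + 1) with hlt | hge
      · have : (s : ℚ) ≤ p := by exact_mod_cast Nat.lt_succ_iff.mp hlt
        nlinarith
      · have : (p : ℚ) + 1 ≤ s := by exact_mod_cast hge
        nlinarith

/-- **STEP 2, floor slots**: weights `≥ pρ` (`ρ > 0`), `Φ ≡ id (mod σ)` on `ε_n`, `w n = pρ` ⇒ every `σ^s`-term of `Φ(C ε_n)`,
`s ≥ 1`, is a constant, non-zero only for `s = p` (the PURE `W`-term `c·σ^p`); so with `pureCoeff Φ n p = 0` the slot is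
FIXED (derived here; THEOREM-F STEP 2: "X fixes `W`" under "no pure `W`-term").
[cite: AbramovichTemkinWlodarczyk2024, Thm. 5.3.1 (2)–(3) (p. 1578)] -/
theorem IsGradedHom.apply_CX_eq_of_floor (hΦ : IsGradedHom w ρ Φ) (hρ : 0 < ρ) (hw : ∀ j, p * ρ ≤ w j) {n : ι}
    (h0 : (Φ (C (MvPolynomial.X n))).coeff 0 = MvPolynomial.X n) (hn : w n = p * ρ) (hpure : pureCoeff Φ n p = 0) :
    Φ (C (MvPolynomial.X n)) = C (MvPolynomial.X n) := by
  have hc : (0 : ℚ) ≤ p * ρ := mul_nonneg (Nat.cast_nonneg p) hρ.le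
  refine Polynomial.ext fun s => ?_
  rw [coeff_C]
  split_ifs with hs
  · subst hs; exact h0
  · have hs1 : (1 : ℚ) ≤ s := by exact_mod_cast Nat.one_le_iff_ne_zero.mpr hs
    have hlt : w n - s * ρ < p * ρ := by rw [hn]; nlinarith
    by_cases hsp : s = p
    · subst hsp
      rw [hΦ.coeff_CX_eq_C_pureCoeff hw hc hlt, hpure, map_zero]
    · refine hΦ.coeff_CX_eq_zero hw hc hlt ?_
      rw [hn]
      intro heq
      exact hsp (by exact_mod_cast (mul_right_cancel₀ hρ.ne' heq).symm)

/-- **STEP 2, `f`-class slots — the face form**: weights `≥ pρ` (`ρ > 0`, `0 < p`), `Φ ≡ id (mod σ)` on `ε_i`, `w i = (p+1)ρ` ⇒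
`Φ(C ε_i) = C ε_i + σ·C M_i + C(C d_i)·σ^{p+1}` with `M_i = [σ¹]Φ(C ε_i)` and `d_i = pureCoeff Φ i (p+1)`: the terms `σ^s`,
`2 ≤ s ≤ p`, weigh strictly between `0` and the floor, `σ^{p+1}` weighs `0`, higher ones negatively (derived here; THEOREM-F
STEP 2: "`X(f) = f + σM(W) + σ^{p+1}d`"). [cite: AbramovichTemkinWlodarczyk2024, Thm. 5.3.1 (2)–(3) (p. 1578)] -/
theorem IsGradedHom.apply_CX_eq_of_fclass (hΦ : IsGradedHom w ρ Φ) (hρ : 0 < ρ) (hp : 0 < p) (hw : ∀ j, p * ρ ≤ w j)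
    {i : ι} (h0 : (Φ (C (MvPolynomial.X i))).coeff 0 = MvPolynomial.X i) (hi : w i = (p + 1) * ρ) :
    Φ (C (MvPolynomial.X i)) = C (MvPolynomial.X i) + X * C ((Φ (C (MvPolynomial.X i))).coeff 1) +
      C (MvPolynomial.C (pureCoeff Φ i (p + 1))) * X ^ (p + 1) := by
  have hc : (0 : ℚ) ≤ p * ρ := mul_nonneg (Nat.cast_nonneg p) hρ.le
  have hp1 : (1 : ℚ) ≤ p := by exact_mod_cast hp
  refine eq_faceForm_of_coeff (by omega) h0 rfl ?_ fun s hs0 hs1 hsq => ?_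
  · refine hΦ.coeff_CX_eq_C_pureCoeff hw hc ?_
    rw [hi]; push_cast; nlinarith
  · have hs2 : (2 : ℚ) ≤ s := by exact_mod_cast (show 2 ≤ s by omega)
    refine hΦ.coeff_CX_eq_zero hw hc ?_ ?_
    · rw [hi]; nlinarith
    · rw [hi]
      intro heq
      have : (p : ℚ) + 1 = s := mul_right_cancel₀ hρ.ne' heq
      exact hsq (by exact_mod_cast this.symm)

/-- **STEP 2, the `σ¹`-coefficient of an `f`-class slot is a linear form in the floor slots**: `M_i = Σ_{w n = pρ} c_{i n}·ε_n`
with `c_{i n} = coeff_{e_n} M_i ∈ k` (derived here; THEOREM-F STEP 2 / STEP 4: "`M_f(W)` linear forms in `W`").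
[cite: AbramovichTemkinWlodarczyk2024, Thm. 5.3.1 (2)–(3) (p. 1578)] -/
theorem IsGradedHom.coeff_one_eq_sum_of_fclass [Fintype ι] [DecidableEq ι] (hΦ : IsGradedHom w ρ Φ) (hρ : 0 < ρ)
    (hp : 0 < p) (hw : ∀ j, p * ρ ≤ w j) {i : ι} (hi : w i = (p + 1) * ρ) :
    (Φ (C (MvPolynomial.X i))).coeff 1 = ∑ n ∈ Finset.univ.filter (fun n => w n = p * ρ),
      MvPolynomial.C (((Φ (C (MvPolynomial.X i))).coeff 1).coeff (Finsupp.single n 1)) * MvPolynomial.X n := by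
  have hc : (0 : ℚ) < p * ρ := mul_pos (by exact_mod_cast hp) hρ
  have h := hΦ.isWeightedHomogeneous_coeff_CX i 1
  rw [hi, Nat.cast_one, one_mul, show ((p : ℚ) + 1) * ρ - ρ = p * ρ by ring] at h
  exact h.eq_sum_C_mul_X_of_weight_eq_floor hw hc

/-- **STEP 2 assembled for one `f`-class slot** (derived here): with `T` the floor class and `c_{i n}` as above,
`Φ(C ε_i) = C ε_i + σ·C(Σ_{n ∈ T} c_{i n} ε_n) + C(C d_i)·σ^{p+1}`. [cite: AbramovichTemkinWlodarczyk2024, Thm. 5.3.1 (2)–(3) (p. 1578)] -/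
theorem IsGradedHom.apply_CX_eq_of_fclass' [Fintype ι] [DecidableEq ι] (hΦ : IsGradedHom w ρ Φ) (hρ : 0 < ρ) (hp : 0 < p)
    (hw : ∀ j, p * ρ ≤ w j) {i : ι} (h0 : (Φ (C (MvPolynomial.X i))).coeff 0 = MvPolynomial.X i) (hi : w i = (p + 1) * ρ) :
    Φ (C (MvPolynomial.X i)) = C (MvPolynomial.X i) +
      X * C (∑ n ∈ Finset.univ.filter (fun n => w n = p * ρ),
        MvPolynomial.C (((Φ (C (MvPolynomial.X i))).coeff 1).coeff (Finsupp.single n 1)) * MvPolynomial.X n) +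
      C (MvPolynomial.C (pureCoeff Φ i (p + 1))) * X ^ (p + 1) := by
  rw [← hΦ.coeff_one_eq_sum_of_fclass hρ hp hw hi]
  exact hΦ.apply_CX_eq_of_fclass hρ hp hw h0 hi

end Shape

end Literature.AlgebraicGeometry.Resolution.WeightedBlowup
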